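import Summits.NavierStokesRegularity.NavierStokesRegularity.Theorems.PalasekTowerBreakdownEpisodeBaseStrainSliceH2Tools
import Literature.Analysis.FluidPDE.AncientMildWeak

/-!
# The strain-currency door at the `H²` level, II: the slice inequality (time-free)

Cell `ns-blowup`, seat `ns-palasek-19179-p2` (g6; holder-of-record lineage of crux
stmt-NavierStokesRegularity-19179 `EpisodeBase`, route `PalasekTowerBreakdown`; `--supports
stmt-NavierStokesRegularity-19179`). Support for the stub `stub_strain_door : StrainDoor` of the strategist line
`Cruxes/EpisodeBase/Lines/straindoor.lean` (cstrat-19179, v2). LABEL: E–C analysis (KERNEL: theorems only; no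
definition, no named fact, no `sorry`; register-free). WHAT THIS IS NOT: not Navier–Stokes evidence — a slice
inequality for given fields; no flow, run, design, certificate or blow-up is exhibited or asserted; it does NOT prove
`StrainDoor`.

THE STATEMENT (`neg_sum_integral_inner_fderiv_rhs_laplacian_le`). Slices as in the `H¹` file
(`…StrainSliceH1`): `u` reference (bounded derivatives, divergence free, strain majorant `σ`, `‖D(Du)‖ ≤ σ₂`,
`‖D(D(∂ₗu))‖ ≤ σ₃`), `W` the divergence-free smooth `L²` difference with the GRADIENT sup bound `‖DW‖ ≤ m₁` (the
second bootstrap quantity), `π`, `r` smooth `L²`, `A = ΔW − [(W·∇)u + (u·∇)W + (W·∇)W] − ∇π − r`. With `Vₗ = ∂ₗW`,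
`D₁ = ∑ₗ∫‖Vₗ‖²`, `H = ∑ₗ∑ₖ∫‖∂ₖVₗ‖²`, `D₃ = ∑ₗ∫‖ΔVₗ‖²`:

  `−∑ₗ ∫⟪∂ₗA, ΔVₗ⟫ ≤ −D₃ + 3σ H + σ₂(∫‖DW‖∑∑‖∂ₖVₗ‖ + ∑ₗ∫‖Vₗ‖∑ₖ‖∂ₖVₗ‖ + ∑∑∫‖∂ₖW‖‖∂ₖVₗ‖) + σ₃ ∑∑∫‖W‖‖∂ₖVₗ‖`
  `  + m₁ (H + √D₁ √D₃) + √(∑∑∫‖∂ₖ∂ₗr‖²) √H`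

— the `H²`-level formal derivative bound `½ d/dt H = −∑ₗ∫⟪∂ₗ∂ₜW, ΔVₗ⟫` of the door (card's top rate `6σ` after
doubling): dissipation `−D₃` (`∂ₗΔ = Δ∂ₗ`); transport (Part III, `2σ`) and stretching (Part IV, `σ`); the cubic term
`∂ₗ[(W·∇)W] = (Vₗ·∇)W + (W·∇)Vₗ` costs `m₁√D₁√D₃` (Cauchy–Schwarz) plus `m₁H` (transport of `Vₗ` by the divergence-free
`W`, Part I with the strain of `W` bounded by `m₁`); the pressure term vanishes (`ΔVₗ` divergence free); the residual by
Green's identity and a double Cauchy–Schwarz.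

References: P. Constantin, C. Foias, *Navier–Stokes Equations*, 1988, Ch. 10 [cite: ConstantinFoiasNSE1988, Ch. 10 Thm. 10.2];
M. Dashti, J. C. Robinson, SIAM J. Numer. Anal. 46 (2008), Thm. 5 [cite: DashtiRobinson2008, Thm. 5].
-/

noncomputable section

set_option linter.dupNamespace false

open MeasureTheory Filter Function Set
open scoped ENNReal NNReal RealInnerProductSpace Topology Laplacian
open Literature.Analysis.FunctionSpaces Literature.Analysis.FluidPDE

namespace Summit.NavierStokesRegularity.NavierStokesRegularity.Theorems.StrainPairing

variable {E : Type*} [NormedAddCommGroup E] [InnerProductSpace ℝ E] [FiniteDimensional ℝ E]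
  [MeasurableSpace E] [BorelSpace E]

/-- **The `H²`-level slice inequality of the strain-currency door.** See the module docstring.
[cite: ConstantinFoiasNSE1988, Ch. 10 Thm. 10.2] [cite: DashtiRobinson2008, Thm. 5] -/
theorem neg_sum_integral_inner_fderiv_rhs_laplacian_le {u W r A : E → E} {π : E → ℝ} {σ σ₂ σ₃ m₁ : ℝ}
    (hu : HasBoundedDerivs u) (hdiv : VectorCalculus.IsDivFree u)
    (hσ : ∀ x ξ : E, |⟪fderiv ℝ u x ξ, ξ⟫| ≤ σ * ‖ξ‖ ^ 2) (hσ₂ : ∀ x, ‖fderiv ℝ (fderiv ℝ u) x‖ ≤ σ₂)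
    (hσ₃ : ∀ (l : Fin (Module.finrank ℝ E)) x,
      ‖fderiv ℝ (fderiv ℝ (fun y => fderiv ℝ u y (stdOrthonormalBasis ℝ E l))) x‖ ≤ σ₃)
    (hW : IsSmoothL2Field W) (hWdiv : VectorCalculus.IsDivFree W) (hm₁0 : 0 ≤ m₁)
    (hm₁ : ∀ x, ‖fderiv ℝ W x‖ ≤ m₁) (hπ : IsSmoothL2Field π) (hr : IsSmoothL2Field r)
    (hA : A = fun x => (Δ W) x - (convect W u x + convect u W x + convect W W x) - gradient π x - r x) :
    -∑ l, ∫ x, ⟪fderiv ℝ A x (stdOrthonormalBasis ℝ E l),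
        (Δ (fun y => fderiv ℝ W y (stdOrthonormalBasis ℝ E l))) x⟫ ≤
      -(∑ l, ∫ x, ‖(Δ (fun y => fderiv ℝ W y (stdOrthonormalBasis ℝ E l))) x‖ ^ 2) +
      3 * σ * (∑ l, ∑ k, ∫ x, ‖fderiv ℝ (fun y => fderiv ℝ W y (stdOrthonormalBasis ℝ E l)) x
          (stdOrthonormalBasis ℝ E k)‖ ^ 2) +
      σ₂ * (∫ x, ‖fderiv ℝ W x‖ * ∑ l, ∑ k, ‖fderiv ℝ (fun y => fderiv ℝ W y (stdOrthonormalBasis ℝ E l)) x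
          (stdOrthonormalBasis ℝ E k)‖) +
      σ₂ * (∑ l, ∫ x, ‖fderiv ℝ W x (stdOrthonormalBasis ℝ E l)‖ *
          ∑ k, ‖fderiv ℝ (fun y => fderiv ℝ W y (stdOrthonormalBasis ℝ E l)) x (stdOrthonormalBasis ℝ E k)‖) +
      σ₂ * (∑ l, ∑ k, ∫ x, ‖fderiv ℝ W x (stdOrthonormalBasis ℝ E k)‖ *
          ‖fderiv ℝ (fun y => fderiv ℝ W y (stdOrthonormalBasis ℝ E l)) x (stdOrthonormalBasis ℝ E k)‖) +
      σ₃ * (∑ l, ∑ k, ∫ x, ‖W x‖ *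
          ‖fderiv ℝ (fun y => fderiv ℝ W y (stdOrthonormalBasis ℝ E l)) x (stdOrthonormalBasis ℝ E k)‖) +
      m₁ * (∑ l, ∑ k, ∫ x, ‖fderiv ℝ (fun y => fderiv ℝ W y (stdOrthonormalBasis ℝ E l)) x
          (stdOrthonormalBasis ℝ E k)‖ ^ 2) +
      m₁ * Real.sqrt (∑ l, ∫ x, ‖fderiv ℝ W x (stdOrthonormalBasis ℝ E l)‖ ^ 2) *
        Real.sqrt (∑ l, ∫ x, ‖(Δ (fun y => fderiv ℝ W y (stdOrthonormalBasis ℝ E l))) x‖ ^ 2) +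
      Real.sqrt (∑ l, ∑ k, ∫ x, ‖fderiv ℝ (fun y => fderiv ℝ r y (stdOrthonormalBasis ℝ E l)) x
          (stdOrthonormalBasis ℝ E k)‖ ^ 2) *
        Real.sqrt (∑ l, ∑ k, ∫ x, ‖fderiv ℝ (fun y => fderiv ℝ W y (stdOrthonormalBasis ℝ E l)) x
          (stdOrthonormalBasis ℝ E k)‖ ^ 2) := by
  set b := stdOrthonormalBasis ℝ E with hb
  haveI : CompleteSpace E := FiniteDimensional.complete ℝ E
  have hWB : HasBoundedDerivs W := hW.toHasBoundedDerivs
  have hu2 : ContDiff ℝ 2 u := hu.contDiff_nat 2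
  have hW1 : ContDiff ℝ 1 W := hW.contDiff_nat 1
  have hW2 : ContDiff ℝ 2 W := hW.contDiff_nat 2
  have hW3 : ContDiff ℝ 3 W := hW.contDiff_nat 3
  -- the fields `Vₗ`, `Uₗ`
  set V : Fin (Module.finrank ℝ E) → E → E := fun l y => fderiv ℝ W y (b l) with hV
  set U : Fin (Module.finrank ℝ E) → E → E := fun l y => fderiv ℝ u y (b l) with hU
  have hVS : ∀ l, IsSmoothL2Field (V l) := fun l => hW.fderiv_apply (b l)
  have hUS : ∀ l, HasBoundedDerivs (U l) := fun l => hu.fderiv_apply (b l)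
  have hΔV : ∀ l, IsSmoothL2Field (Δ (V l)) := fun l => (hVS l).laplacian
  have hVdiv : ∀ l, VectorCalculus.IsDivFree (V l) := fun l => VectorCalculus.IsDivFree.fderiv_apply hW2 hWdiv (b l)
  have hΔVdiv : ∀ l, VectorCalculus.IsDivFree (Δ (V l)) := fun l =>
    isDivFree_laplacian_of_contDiff ((hVS l).contDiff_nat 3) (hVdiv l)
  -- the three nonlinear terms and their regularity
  set N₁ : E → E := convect W u with hN₁
  set N₂ : E → E := convect u W with hN₂
  set N₃ : E → E := convect W W with hN₃
  have hN₁c : ContDiff ℝ 1 N₁ := (hu2.fderiv_right (m := 1) le_rfl).clm_apply hW1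
  have hN₂c : ContDiff ℝ 1 N₂ := (hW.convect hu).contDiff_nat 1
  have hN₃c : ContDiff ℝ 1 N₃ := (hW.convect hWB).contDiff_nat 1
  -- `∂ₗ A`
  have hdA : ∀ l x, fderiv ℝ A x (b l) = (Δ (V l)) x - (fderiv ℝ N₁ x (b l) + fderiv ℝ N₂ x (b l) + fderiv ℝ N₃ x (b l)) -
      gradient (fun y => fderiv ℝ π y (b l)) x - fderiv ℝ r x (b l) :=
    fun l x => fderiv_apply_rhs_eq hW3 hN₁c hN₂c hN₃c (hπ.contDiff_nat 2) (hr.contDiff_nat 1) hA x (b l)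
  -- `∂ₗ N₃ = (Vₗ·∇)W + (W·∇)Vₗ`, `∂ₗ N₁ = (Vₗ·∇)u + (W·∇)Uₗ` (as smooth / `L²` fields)
  have hdN₃ : ∀ l x, fderiv ℝ N₃ x (b l) = convect (V l) W x + convect W (V l) x := by
    intro l x; rw [hN₃, fderiv_convect_apply hW1 hW2 x (b l)]; rfl
  have hdN₁ : ∀ l x, fderiv ℝ N₁ x (b l) = convect (V l) u x + convect W (U l) x := by
    intro l x; rw [hN₁, fderiv_convect_apply hW1 hu2 x (b l)]; rfl
  -- `L²` memberships
  obtain ⟨M₁, hM₁⟩ := hu.exists_norm_fderiv_le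
  have hU1 : ∀ l x w, ‖fderiv ℝ (U l) x w‖ ≤ σ₂ * ‖w‖ := fun l x w =>
    (norm_fderiv_fderiv_apply_le hu2 x w l).trans (mul_le_mul_of_nonneg_right (hσ₂ x) (norm_nonneg _))
  have hmN₁ : ∀ l, MemLp (fun x => fderiv ℝ N₁ x (b l)) 2 volume := by
    intro l
    have h1 : MemLp (convect (V l) u) 2 volume := by
      refine MemLp.of_le_mul (c := M₁) (hVS l).memLp_two ?_ (Eventually.of_forall fun x => ?_)
      · exact ((hu2.continuous_fderiv (by norm_num)).clm_apply (hVS l).continuous).aestronglyMeasurable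
      · rw [convect_apply]
        exact (ContinuousLinearMap.le_opNorm _ _).trans (mul_le_mul_of_nonneg_right (hM₁ x) (norm_nonneg _))
    have h2 : MemLp (convect W (U l)) 2 volume := by
      refine MemLp.of_le_mul (c := σ₂) hW.memLp_two ?_ (Eventually.of_forall fun x => ?_)
      · exact ((((hUS l).contDiff_nat 1).continuous_fderiv one_ne_zero).clm_apply hW.continuous).aestronglyMeasurable
      · rw [convect_apply]; exact hU1 l x _
    have he : (fun x => fderiv ℝ N₁ x (b l)) = convect (V l) u + convect W (U l) := by
      funext x; rw [hdN₁ l x]; rfl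
    rw [he]; exact h1.add h2
  have hCA : ∀ l, IsSmoothL2Field (convect (V l) W) := fun l => hW.convect (hVS l).toHasBoundedDerivs
  have hCB : ∀ l, IsSmoothL2Field (convect W (V l)) := fun l => (hVS l).convect hWB
  -- integrability of the pairings against `ΔVₗ`
  have iΔ : ∀ l, Integrable (fun x => ⟪(Δ (V l)) x, (Δ (V l)) x⟫) volume := fun l =>
    integrable_inner_of_memLp_two (hΔV l).memLp_two (hΔV l).memLp_two
  have iN₁ : ∀ l, Integrable (fun x => ⟪fderiv ℝ N₁ x (b l), (Δ (V l)) x⟫) volume := fun l =>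
    integrable_inner_of_memLp_two (hmN₁ l) (hΔV l).memLp_two
  have iN₂ : ∀ l, Integrable (fun x => ⟪fderiv ℝ N₂ x (b l), (Δ (V l)) x⟫) volume := fun l =>
    integrable_inner_of_memLp_two ((hW.convect hu).memLp_fderiv_apply (b l)) (hΔV l).memLp_two
  have iN₃ : ∀ l, Integrable (fun x => ⟪fderiv ℝ N₃ x (b l), (Δ (V l)) x⟫) volume := fun l =>
    integrable_inner_of_memLp_two ((hW.convect hWB).memLp_fderiv_apply (b l)) (hΔV l).memLp_two
  have iπ : ∀ l, Integrable (fun x => ⟪gradient (fun y => fderiv ℝ π y (b l)) x, (Δ (V l)) x⟫) volume := fun l =>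
    integrable_inner_of_memLp_two ((hπ.fderiv_apply (b l)).gradient).memLp_two (hΔV l).memLp_two
  have ir : ∀ l, Integrable (fun x => ⟪fderiv ℝ r x (b l), (Δ (V l)) x⟫) volume := fun l =>
    integrable_inner_of_memLp_two (hr.memLp_fderiv_apply (b l)) (hΔV l).memLp_two
  -- the split, per `l`
  have hsplit : ∀ l, ∫ x, ⟪fderiv ℝ A x (b l), (Δ (V l)) x⟫ =
      (∫ x, ⟪(Δ (V l)) x, (Δ (V l)) x⟫) -
        ((∫ x, ⟪fderiv ℝ N₁ x (b l), (Δ (V l)) x⟫) + (∫ x, ⟪fderiv ℝ N₂ x (b l), (Δ (V l)) x⟫) +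
          ∫ x, ⟪fderiv ℝ N₃ x (b l), (Δ (V l)) x⟫) -
        (∫ x, ⟪gradient (fun y => fderiv ℝ π y (b l)) x, (Δ (V l)) x⟫) -
        ∫ x, ⟪fderiv ℝ r x (b l), (Δ (V l)) x⟫ := by
    intro l
    have hpt : ∀ x, ⟪fderiv ℝ A x (b l), (Δ (V l)) x⟫ = ⟪(Δ (V l)) x, (Δ (V l)) x⟫ -
        (⟪fderiv ℝ N₁ x (b l), (Δ (V l)) x⟫ + ⟪fderiv ℝ N₂ x (b l), (Δ (V l)) x⟫ +
          ⟪fderiv ℝ N₃ x (b l), (Δ (V l)) x⟫) -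
        ⟪gradient (fun y => fderiv ℝ π y (b l)) x, (Δ (V l)) x⟫ - ⟪fderiv ℝ r x (b l), (Δ (V l)) x⟫ := by
      intro x
      rw [hdA l x]
      simp only [inner_sub_left, inner_add_left]
    have i12 := (iN₁ l).add (iN₂ l)
    have i12' : Integrable (fun x => ⟪fderiv ℝ N₁ x (b l), (Δ (V l)) x⟫ + ⟪fderiv ℝ N₂ x (b l), (Δ (V l)) x⟫)
        volume := i12
    have i3 : Integrable (fun x => ⟪fderiv ℝ N₁ x (b l), (Δ (V l)) x⟫ + ⟪fderiv ℝ N₂ x (b l), (Δ (V l)) x⟫ +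
        ⟪fderiv ℝ N₃ x (b l), (Δ (V l)) x⟫) volume := i12'.add (iN₃ l)
    have i2 : Integrable (fun x => ⟪(Δ (V l)) x, (Δ (V l)) x⟫ -
        (⟪fderiv ℝ N₁ x (b l), (Δ (V l)) x⟫ + ⟪fderiv ℝ N₂ x (b l), (Δ (V l)) x⟫ +
          ⟪fderiv ℝ N₃ x (b l), (Δ (V l)) x⟫)) volume := (iΔ l).sub i3
    have i1 : Integrable (fun x => ⟪(Δ (V l)) x, (Δ (V l)) x⟫ -
        (⟪fderiv ℝ N₁ x (b l), (Δ (V l)) x⟫ + ⟪fderiv ℝ N₂ x (b l), (Δ (V l)) x⟫ +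
          ⟪fderiv ℝ N₃ x (b l), (Δ (V l)) x⟫) -
        ⟪gradient (fun y => fderiv ℝ π y (b l)) x, (Δ (V l)) x⟫) volume := i2.sub (iπ l)
    simp_rw [hpt]
    rw [integral_sub i1 (ir l), integral_sub i2 (iπ l), integral_sub (iΔ l) i3, integral_add i12' (iN₃ l),
      integral_add (iN₁ l) (iN₂ l)]
  -- the dissipation
  have vΔ : ∀ l, ∫ x, ⟪(Δ (V l)) x, (Δ (V l)) x⟫ = ∫ x, ‖(Δ (V l)) x‖ ^ 2 := fun l =>
    integral_congr_ae (Eventually.of_forall fun x => real_inner_self_eq_norm_sq _)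
  -- TERM 1 (stretching, Part IV) and TERM 2 (transport, Part III)
  have vT₁ := (le_abs_self _).trans (abs_sum_integral_inner_fderiv_convect_laplacian_le_stretching hu hW hσ hσ₂ hσ₃)
  have vT₂ := (le_abs_self _).trans (abs_sum_integral_inner_fderiv_convect_laplacian_le hu hdiv hW hσ hσ₂)
  -- TERM 3 (cubic)
  have hstrainW : ∀ x ξ : E, |⟪fderiv ℝ W x ξ, ξ⟫| ≤ m₁ * ‖ξ‖ ^ 2 := by
    intro x ξ
    calc |⟪fderiv ℝ W x ξ, ξ⟫| ≤ ‖fderiv ℝ W x ξ‖ * ‖ξ‖ := abs_real_inner_le_norm _ _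
      _ ≤ ‖fderiv ℝ W x‖ * ‖ξ‖ * ‖ξ‖ := by gcongr; exact ContinuousLinearMap.le_opNorm _ _
      _ ≤ m₁ * ‖ξ‖ ^ 2 := by rw [sq, ← mul_assoc]; gcongr; exact hm₁ x
  have vT₃ : ∑ l, ∫ x, ⟪fderiv ℝ N₃ x (b l), (Δ (V l)) x⟫ ≤
      m₁ * (∑ l, ∑ k, ∫ x, ‖fderiv ℝ (V l) x (b k)‖ ^ 2) +
        m₁ * Real.sqrt (∑ l, ∫ x, ‖V l x‖ ^ 2) * Real.sqrt (∑ l, ∫ x, ‖(Δ (V l)) x‖ ^ 2) := by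
    have hsp : ∀ l, ∫ x, ⟪fderiv ℝ N₃ x (b l), (Δ (V l)) x⟫ =
        (∫ x, ⟪convect (V l) W x, (Δ (V l)) x⟫) + ∫ x, ⟪convect W (V l) x, (Δ (V l)) x⟫ := by
      intro l
      simp_rw [hdN₃ l, inner_add_left]
      exact integral_add (integrable_inner_of_memLp_two (hCA l).memLp_two (hΔV l).memLp_two)
        (integrable_inner_of_memLp_two (hCB l).memLp_two (hΔV l).memLp_two)
    have hB : ∀ l, ∫ x, ⟪convect W (V l) x, (Δ (V l)) x⟫ ≤ m₁ * ∑ k, ∫ x, ‖fderiv ℝ (V l) x (b k)‖ ^ 2 :=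
      fun l => (le_abs_self _).trans (abs_integral_inner_convect_laplacian_le_of_strain hWB hWdiv (hVS l) hstrainW)
    have hA' : ∀ l, ∫ x, ⟪convect (V l) W x, (Δ (V l)) x⟫ ≤ ∫ x, (m₁ * ‖V l x‖) * ‖(Δ (V l)) x‖ := by
      intro l
      refine integral_mono (integrable_inner_of_memLp_two (hCA l).memLp_two (hΔV l).memLp_two)
        (((hVS l).memLp_two.norm.const_mul m₁).integrable_mul (hΔV l).memLp_two.norm) fun x => ?_
      refine (real_inner_le_norm _ _).trans (mul_le_mul_of_nonneg_right ?_ (norm_nonneg _))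
      rw [convect_apply]
      calc ‖fderiv ℝ W x (V l x)‖ ≤ ‖fderiv ℝ W x‖ * ‖V l x‖ := ContinuousLinearMap.le_opNorm _ _
        _ ≤ m₁ * ‖V l x‖ := mul_le_mul_of_nonneg_right (hm₁ x) (norm_nonneg _)
    have hA'' : ∑ l, ∫ x, (m₁ * ‖V l x‖) * ‖(Δ (V l)) x‖ ≤
        m₁ * Real.sqrt (∑ l, ∫ x, ‖V l x‖ ^ 2) * Real.sqrt (∑ l, ∫ x, ‖(Δ (V l)) x‖ ^ 2) := by
      have hc : ∀ l, ∫ x, (m₁ * ‖V l x‖) * ‖(Δ (V l)) x‖ = m₁ * ∫ x, ‖V l x‖ * ‖(Δ (V l)) x‖ := by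
        intro l; rw [← integral_const_mul]; exact integral_congr_ae (Eventually.of_forall fun x => by ring)
      simp_rw [hc]
      rw [← Finset.mul_sum, mul_assoc]
      refine mul_le_mul_of_nonneg_left ?_ hm₁0
      exact sum_integral_mul_le_sqrt_mul_sqrt (fun l => (hVS l).memLp_two.norm) (fun l => (hΔV l).memLp_two.norm)
        (fun l x => norm_nonneg _) (fun l x => norm_nonneg _)
    calc ∑ l, ∫ x, ⟪fderiv ℝ N₃ x (b l), (Δ (V l)) x⟫
        = ∑ l, ((∫ x, ⟪convect (V l) W x, (Δ (V l)) x⟫) + ∫ x, ⟪convect W (V l) x, (Δ (V l)) x⟫) :=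
          Finset.sum_congr rfl fun l _ => hsp l
      _ ≤ ∑ l, ((∫ x, (m₁ * ‖V l x‖) * ‖(Δ (V l)) x‖) + m₁ * ∑ k, ∫ x, ‖fderiv ℝ (V l) x (b k)‖ ^ 2) :=
          Finset.sum_le_sum fun l _ => add_le_add (hA' l) (hB l)
      _ = (∑ l, ∫ x, (m₁ * ‖V l x‖) * ‖(Δ (V l)) x‖) + m₁ * ∑ l, ∑ k, ∫ x, ‖fderiv ℝ (V l) x (b k)‖ ^ 2 := by
          rw [Finset.sum_add_distrib, Finset.mul_sum]
      _ ≤ _ := by linarith [hA'']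
  -- TERM π (vanishes) and TERM r (Green + double Cauchy–Schwarz)
  have vπ : ∀ l, ∫ x, ⟪gradient (fun y => fderiv ℝ π y (b l)) x, (Δ (V l)) x⟫ = 0 := by
    intro l
    have hcomm : ∫ x, ⟪gradient (fun y => fderiv ℝ π y (b l)) x, (Δ (V l)) x⟫ =
        ∫ x, ⟪(Δ (V l)) x, gradient (fun y => fderiv ℝ π y (b l)) x⟫ :=
      integral_congr_ae (Eventually.of_forall fun x => real_inner_comm _ _)
    rw [hcomm, (hΔV l).integral_inner_gradient (hπ.fderiv_apply (b l))]
    simp only [hΔVdiv l _, zero_mul, integral_zero, neg_zero]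
  have vr : ∑ l, ∫ x, ⟪fderiv ℝ r x (b l), (Δ (V l)) x⟫ ≤
      Real.sqrt (∑ l, ∑ k, ∫ x, ‖fderiv ℝ (fun y => fderiv ℝ r y (b l)) x (b k)‖ ^ 2) *
        Real.sqrt (∑ l, ∑ k, ∫ x, ‖fderiv ℝ (V l) x (b k)‖ ^ 2) := by
    have hG : ∀ l, ∫ x, ⟪fderiv ℝ r x (b l), (Δ (V l)) x⟫ =
        -∑ k, ∫ x, ⟪fderiv ℝ (fun y => fderiv ℝ r y (b l)) x (b k), fderiv ℝ (V l) x (b k)⟫ :=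
      fun l => integral_inner_laplacian_eq_neg_sum (hr.fderiv_apply (b l)) (hVS l)
    simp_rw [hG]
    rw [Finset.sum_neg_distrib]
    refine (neg_le_abs _).trans ?_
    exact abs_sum_sum_integral_inner_le_sqrt_mul_sqrt (fun l k => (hr.fderiv_apply (b l)).memLp_fderiv_apply (b k))
      (fun l k => (hVS l).memLp_fderiv_apply (b k))
  -- assembly: fold `fun y => ∂ₗ W` into `V l`, split, and collect
  have hVl : ∀ l, (fun y => fderiv ℝ W y (b l)) = V l := fun l => rfl
  simp only [hVl]
  simp_rw [hsplit, vΔ, vπ]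
  simp only [sub_zero, Finset.sum_sub_distrib, Finset.sum_add_distrib]
  linarith [vT₁, vT₂, vT₃, vr]

end Summit.NavierStokesRegularity.NavierStokesRegularity.Theorems.StrainPairing

end
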